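import Summits.ResolutionOfSingularities.ResolutionOfSingularities.Theorems.HilbertSamuelEliminationCampaignW42VertexGame
import Summits.ResolutionOfSingularities.ResolutionOfSingularities.Theorems.HilbertSamuelEliminationCampaignW42VertexGameRank
import Summits.ResolutionOfSingularities.ResolutionOfSingularities.Theorems.HilbertSamuelEliminationCampaignW42VertexGameTermination
import Mathlib.Data.Fintype.Fin
import Mathlib.Data.Finset.Max
import Mathlib.Logic.Relation
import Mathlib.Order.WellFounded

/-!
# [OURS · L1 W4.2] The vertex game: PROGRESS (no deadlock), RESOLUTION in finitely many moves, and TIGHTNESS at `m = 0`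
# (proof file 4 for `…CampaignW42VertexGame.lean`; `--supports stmt-ResolutionOfSingularities-19965`)

HONEST FRAMING. OURS (seat res-L1-s42-pv-2, slot W4.2 / obstruction O2); nothing here is a statement of H. Hironaka's
manuscript [Hironaka2017]; AI-made, AI review is weaker than expert review. Theorems about the validated combinatorial
MODEL of the CJS walk on binomial threefolds, not about schemes; the O2 items 19964/19965 and the CORE stay OPEN.

WHY THIS FILE. `labelStrategyWins` (p511912) says that no play is infinite. For the reading «the CJS strategy WINS
Hironaka's one-vertex game» one also needs that the rules never DEADLOCK: a position admits a move iff it is unresolved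
(`comps ≠ ∅`, equivalently `m ≤ a₀ + a₁ + a₂`, i.e. the point still has multiplicity `m`), for EVERY chart the adversary may
pick. Hence (for `0 < m`) every maximal play — whatever the charts — ends at a resolved position after finitely many
moves (`exists_resolved`), which is the game-theoretic content of termination. Finally the hypothesis `0 < m` is needed:
for `m = 0` all three coordinate planes are components for ever and the END move on the oldest one fixes the position
(`step_self_zero`, `not_labelStrategyWins_zero`) — a non-vacuity check of `Step` as well.
-/

set_option linter.dupNamespace false -- mandated namespace of this single-conjunct summit

namespace Summit.ResolutionOfSingularities.ResolutionOfSingularities.Theorems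

namespace CampaignW42.VertexGame

open Finset

variable {m : ℕ}

/-! ## Resolved positions -/

/-- A position is resolved (no component through the point) iff the order `|a|` is below `m`. [folklore] -/
theorem comps_eq_empty_iff {a : Fin 3 → ℕ} : comps m a = ∅ ↔ total a < m := by
  constructor
  · intro h
    by_contra hlt
    rw [not_lt] at hlt
    -- a nonempty big index set of least cardinality is a component (the whole set is nonempty and big)
    set F := (univ : Finset (Finset (Fin 3))).filter fun S => S.Nonempty ∧ m ≤ ∑ i ∈ S, a i with hF
    have huniv : (univ : Finset (Fin 3)) ∈ F := by
      rw [hF, mem_filter]; exact ⟨mem_univ _, univ_nonempty, hlt⟩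
    obtain ⟨S, hS, hmin⟩ := Finset.exists_min_image F Finset.card ⟨univ, huniv⟩
    rw [hF, mem_filter] at hS
    have hSc : S ∈ comps m a := by
      refine mem_comps_of hS.2.1 hS.2.2 fun T hT hTne => ?_
      by_contra hge
      rw [not_lt] at hge
      have hT' : T ∈ F := by rw [hF, mem_filter]; exact ⟨mem_univ _, hTne, hge⟩
      exact absurd (hmin T hT') (not_le.2 (card_lt_card hT))
    rw [h] at hSc
    exact notMem_empty _ hSc
  · intro h
    rw [eq_empty_iff_forall_notMem]
    intro S hS
    exact absurd (lt_of_le_of_lt (le_trans (le_sum_of_mem_comps hS) (sum_le_total a S)) h) (lt_irrefl _)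

/-! ## Progress: an unresolved position has a move into every chart of a legal centre -/

/-- Every legal centre followed into any of its charts IS a move (the successor is determined). [folklore] -/
theorem step_of_isCentre {s : State} {isEnd : Bool} {U : Finset (Fin 3)} {c : Fin 3} (h : IsCentre m s isEnd U)
    (hc : c ∈ U) : Step m s ⟨transform m s.a U c, newLabel m s isEnd U c⟩ :=
  ⟨isEnd, U, c, h, hc, rfl, fun _ _ => rfl⟩

/-- An unresolved position has a legal (CJS) centre, and it is nonempty. [folklore] -/
theorem exists_isCentre {s : State} (h : (comps m s.a).Nonempty) :
    ∃ (isEnd : Bool) (U : Finset (Fin 3)), IsCentre m s isEnd U ∧ U.Nonempty := by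
  -- the oldest class is nonempty
  obtain ⟨S₀, hS₀, hmin⟩ := Finset.exists_min_image (comps m s.a) s.lab h
  have hL : S₀ ∈ leastClass m s := mem_leastClass.2 ⟨hS₀, hmin⟩
  by_cases hcard : (leastClass m s).card = 1
  · obtain ⟨S, hS⟩ := card_eq_one.1 hcard
    have : S₀ = S := by rw [hS, mem_singleton] at hL; exact hL
    subst this
    exact ⟨true, S₀, IsCentre.end_ S₀ hS, nonempty_of_mem_comps hS₀⟩
  · have h2 : 2 ≤ (leastClass m s).card := by
      have := card_pos.2 ⟨S₀, hL⟩; omega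
    exact ⟨false, (leastClass m s).biUnion id, IsCentre.arr _ Subset.rfl h2,
      (nonempty_of_mem_comps hS₀).mono (subset_biUnion_of_mem id hL)⟩

/-- **Progress.** A position admits a move iff it is unresolved. [folklore] -/
theorem exists_step_iff {s : State} : (∃ s', Step m s s') ↔ (comps m s.a).Nonempty := by
  constructor
  · rintro ⟨s', isEnd, U, c, hcen, -, -, -⟩
    cases hcen with
    | end_ S₀ hLC =>
      exact ⟨_, mem_comps_of_mem_leastClass (by rw [hLC]; exact mem_singleton_self _)⟩
    | arr sub hsub hcard =>
      obtain ⟨S, hS⟩ := card_pos.1 (by omega : 0 < sub.card)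
      exact ⟨S, mem_comps_of_mem_leastClass (hsub hS)⟩
  · intro h
    obtain ⟨isEnd, U, hcen, ⟨c, hc⟩⟩ := exists_isCentre h
    exact ⟨_, step_of_isCentre hcen hc⟩

/-- A position without a move is resolved: `|a| < m`. [folklore] -/
theorem total_lt_of_no_step {s : State} (h : ∀ s', ¬ Step m s s') : total s.a < m := by
  rw [← comps_eq_empty_iff, ← not_nonempty_iff_eq_empty, ← exists_step_iff]
  exact fun ⟨s', hs'⟩ => h s' hs'

/-! ## Resolution in finitely many moves -/

/-- **Every play can be continued until, and only until, the point is resolved; for `0 < m` this happens after finitely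
many moves**: from every position some finite play reaches a resolved position. (Together with `labelStrategyWins` —
EVERY play is finite — and progress, EVERY maximal play ends resolved, whatever charts are chosen.) [folklore] -/
theorem exists_resolved (hm : 0 < m) (s : State) :
    ∃ s', Relation.ReflTransGen (Step m) s s' ∧ total s'.a < m := by
  induction s using (labelStrategyWins hm).induction with
  | _ s ih =>
    by_cases h : ∃ s', Step m s s'
    · obtain ⟨s', hs'⟩ := h
      obtain ⟨s'', h'', hres⟩ := ih s' hs'
      exact ⟨s'', Relation.ReflTransGen.head hs' h'', hres⟩
    · push Not at h
      exact ⟨s, Relation.ReflTransGen.refl, total_lt_of_no_step h⟩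

/-- **Every maximal play ends resolved**: if a play from `s` can no longer be continued at `s'`, then `s'` is resolved.
(The adversarial reading: whatever charts are chosen, the CJS strategy reaches multiplicity `< m`.) [folklore] -/
theorem resolved_of_maximal {s s' : State} (_h : Relation.ReflTransGen (Step m) s s') (hmax : ∀ s'', ¬ Step m s' s'') :
    total s'.a < m :=
  total_lt_of_no_step hmax

/-! ## Tightness: the game with `m = 0` never ends -/

/-- For `m = 0` the position `a = 0` with the plane `{2}` oldest moves to ITSELF (END on `{2}` into chart `2`): the
relation `Step 0` has a loop — in particular `Step` is not a vacuous relation. [folklore] -/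
theorem step_self_zero :
    Step 0 ⟨fun _ => 0, fun S => if S = {2} then 0 else 1⟩ ⟨fun _ => 0, fun S => if S = {2} then 0 else 1⟩ := by
  refine ⟨true, {2}, 2, IsCentre.end_ {2} (by decide), by decide, ?_, by decide⟩
  funext i
  simp [transform]

/-- **The hypothesis `0 < m` of `labelStrategyWins` is necessary**: the CJS label strategy does not win the degenerate
game `m = 0` (every coordinate plane is a component for ever). [folklore] -/
theorem not_labelStrategyWins_zero : ¬ LabelStrategyWins 0 := by
  intro h
  have key : ∀ s, Acc (flip (Step 0)) s → s ≠ ⟨fun _ => 0, fun S => if S = {2} then 0 else 1⟩ := by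
    intro s hacc
    induction hacc with
    | intro s _ ih => intro hs; subst hs; exact ih _ step_self_zero rfl
  exact key _ (h.apply _) rfl

end CampaignW42.VertexGame

end Summit.ResolutionOfSingularities.ResolutionOfSingularities.Theorems
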